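import Summits.ABC.IUTFork.Cor312NotLicencePrVolSharpConst
import Summits.ABC.IUTFork.Cor312PilotKummerCompat
import Mathlib.Algebra.Order.Archimedean.Basic
import HarnessLib

/-!
# [IUTchIII] Cor. 3.12, Step (xi-f) `Licence` at the print-normalised assembled real setting with SHARP pilot
# regions READ OFF REALISING IDELES — fails for every datum with `‖t_{q,x₀}‖ < ε` at one bad place (`ε` free of the
# ideles); the hull-level residual S_H under the q-pin fails with it

PROOF-ONLY record file (D-0012; no definitions, no `Prop` facts) of the abc-iut cell (WAVE-5 discharge seat
abc-iut-w5-d107, gen 6; second hand on the C-R12 (b) TEST of abc-iut-plan / abc-iut-C-cert-2, director-abc EVENT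
DIRECTIVE (E3)); sequel of this seat's `Cor312NotLicencePrVolSharp` (lattice criterion) and
`Cor312NotLicencePrVolSharpConst` (threshold form at a constant tuple). TAKES NO SIDE on [IUTchIII] Cor. 3.12.

CONTENTS, at abc-iut-c312-7's `Real.settingPrVolSharp … tq t …` for a prime `p` and a label `j = i+1` with `j ≥ 2`:
* §1 for ideles REALISING `P_Θ`, `P_q` in Dupuy–Hilado's normalisation (3.4) (abc-iut-c312-7's binders `ht`, `htq`):
  `norm_qIdele_le_one_of_realises`, `norm_thetaIdele_le_one_of_realises`, `norm_thetaIdele_eq_pow_of_realises`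
  (`‖t_{Θ,j,v}‖ = ‖t_{q,v}‖^{j²}`; abc-iut-w4-d036 `log_norm_thetaIdele_eq_of_realises`);
* §2 **`exists_eps_not_licence_settingPrVolSharp_of_realises`**: `∃ ε > 0`, depending only on the setting data other
  than the ideles, such that for ALL realising ideles and every place `x₀ | p` with `‖t_{q,x₀}‖ < ε`:
  `¬ Thm311ToCor312.Licence (settingPrVolSharp … tq t …)` (`ε := min 1 (C·p)⁻¹` with the parent file's threshold `C`;
  the exponent `m` with `‖t_{q,x₀}‖^{j²} ≤ p^{−m} < p·‖t_{q,x₀}‖^{j²}` is Mathlib's `exists_mem_Ico_zpow`);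
* §3 **`exists_eps_not_pilotKummerCompatHull_settingPrVolSharp_of_realises`**: the same `ε` refutes, for every region
  reading `ρ` and q-datum `qK` satisfying the q-PIN, abc-iut-w5-d068's hull-level residual
  `Cor312Vol.PilotKummerCompatHull` (the S_H line of `Conditional.abc_of_S_v3`) at the lattice situation
  `LatticeSituation.ofShells (logShellsDH …) …` of abc-iut-c312-5 (`licence_of_pilotKummerCompatHull`).

READING (neutral, numbers not adjectives). `‖t_{q,x₀}‖ < ε` is `ord_{x₀}(t_q) = P_q(x₀)·[F_{x₀}:ℚ_p]/… >` a constant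
of the field data, i.e. `ord_{x₀}(q_{x₀})` LARGE — the regime of the `λ`-line points of the route `IUTThetaPilot`
(unbounded `ord_v(q_v)`) at any fixed bad place over `p`. In that regime, in our typing and in the SHARP reading
(Θ-possible-image set constant in `m`; (Ind2) = Dupuy–Hilado's factorwise lattice automorphisms of `logShellsDH`),
the typed REGION-level (abc-iut-C-cert-1 `Cor312PinnedHonestReal`, p430714) AND HULL-level readings of the
(xi-d)–(xi-f) clause both fail at the honestly-scaled genuine setting; below `ε` the hull-level reading is OPEN
(log-shell inflation vs `(j²−1)·ord(t_q)`, the S-lane's slot-symmetrised computation). Nothing here bears on the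
NUMBER-level Corollary (`Cor22.Cor312AtDatum`) or on any author's intended reading. [claim: Mochizuki2012, status:
disputed] for [IUTchIII] Cor. 3.12 Step (xi-f) / Thm. 3.11 (iii)(c); [cite: DupuyHilado2025, §3.3, §3.4, §3.9, §4.9,
§4.10]; [cite: ScholzeStix2018, §2.2 pp. 9–10]. HONEST FRAMING: nothing here asserts that abc or [IUTchIII] Cor. 3.12
is proved or refuted; typed ≠ proved; instantiated ≠ endorsed.
-/

noncomputable section

open Set Function NumberField IsDedekindDomain
open scoped Pointwise

namespace Summit.ABC

namespace IUTFork

namespace Thm311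

namespace Real

open Cor312 Cor312Vol Literature.IUT.LogThetaLattice Literature.IUT.LogVolume

variable {F : Type} [Field F] [NumberField F] (X : PilotData F) {logv : PadicLogs F} (hlog : LogvAnalytic logv)
  (M : Type) [Field M] [NumberField M]
  (archPk : ∀ (j : (thetaIndex X).Label) (vQ : (thetaIndex X).VQ), Set ((logShellsDH X logv).Packet j vQ))
  (archSub : ∀ (j : (thetaIndex X).Label) (v : (thetaIndex X).V),
    Set ((logShellsDH X logv).Packet j ((thetaIndex X).over v)))
  (Ψ : ℤ → ∀ v : (thetaIndex X).V, v ∈ (thetaIndex X).Vbad → Set ((logShellsDH X logv).StarPacket v))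
  (act : ℤ → ∀ v : (thetaIndex X).V, v ∈ (thetaIndex X).Vbad →
    (logShellsDH X logv).StarPacket v → Module.End ℚ ((logShellsDH X logv).StarPacket v))
  (Mmod : ℤ → ∀ j : (thetaIndex X).LabelStar, Set ((logShellsDH X logv).GlobalPacket j.1))
  (region : ℤ → ∀ j : (thetaIndex X).LabelStar, FinDivisor M → ∀ vQ : (thetaIndex X).VQ,
    Set ((logShellsDH X logv).Packet j.1 vQ))
  (n : ℤ) {HT : Type} {LogLink : HT → HT → Type} {IsFull : ∀ {s t : HT}, LogLink s t → Prop}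
  (lat : LGPGaussianLogThetaLattice LogLink IsFull)
  {Frd : Type} {IsoF : Frd → Frd → Type} {Ob : Frd → Type} {realify : Frd → Frd} {Strip : Type}
  {IsoS : Strip → Strip → Type} {Mv : ∀ v : (thetaIndex X).V, v ∈ (thetaIndex X).Vbad → Type}
  [∀ v h, Monoid (Mv v h)]
  (sig : GlobalLGPFrobenioidSignature (thetaIndex X).lstar (thetaIndex X).V (· ∈ (thetaIndex X).Vbad)
    Frd IsoF Ob realify Strip IsoS Mv)
  (split : SplittingMonoids Mv) {ObΔ : Type} {N : ∀ v : (thetaIndex X).V, v ∈ (thetaIndex X).Vbad → Type}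
  [∀ v h, Monoid (N v h)] (qData : QPilotData ObΔ N)

/-! ## §1. Norms of realising ideles -/

section Realising

variable (t : ∀ (pp : Nat.Primes) (_ : Fin X.lstar) (x : (thetaIndex X).Fibre (.inr pp)),
    haveI : Fact (pp : ℕ).Prime := ⟨pp.2⟩; kOf X pp.1 x)
  (ht0 : ∀ pp i x, t pp i x ≠ 0)
  (ht : ∀ (pp : Nat.Primes) (i : Fin X.lstar) (x : (thetaIndex X).Fibre (.inr pp)),
    haveI : Fact (pp : ℕ).Prime := ⟨pp.2⟩
    Real.log ‖t pp i x‖ = -(X.thetaPilot i (placeOf X pp.1 x)) * logNorm F (placeOf X pp.1 x) /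
      localDegree F (placeOf X pp.1 x))
  (tq : ∀ (pp : Nat.Primes) (x : (thetaIndex X).Fibre (.inr pp)), haveI : Fact (pp : ℕ).Prime := ⟨pp.2⟩; kOf X pp.1 x)
  (htq0 : ∀ pp x, tq pp x ≠ 0)
  (htq : ∀ (pp : Nat.Primes) (x : (thetaIndex X).Fibre (.inr pp)),
    haveI : Fact (pp : ℕ).Prime := ⟨pp.2⟩
    Real.log ‖tq pp x‖ = -(X.qPilot (placeOf X pp.1 x)) * logNorm F (placeOf X pp.1 x) /
      localDegree F (placeOf X pp.1 x))

include htq0 htq in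
/-- A `q`-idele realising `P_q ≥ 0` has norm `≤ 1`. [cite: DupuyHilado2025, §3.3, §3.4] -/
theorem norm_qIdele_le_one_of_realises (pp : Nat.Primes) (x : (thetaIndex X).Fibre (.inr pp)) :
    ‖tq pp x‖ ≤ 1 := by
  haveI : Fact (pp : ℕ).Prime := ⟨pp.2⟩
  have hq0 : 0 < ‖tq pp x‖ := norm_pos_iff.mpr (htq0 pp x)
  have hlog : Real.log ‖tq pp x‖ ≤ 0 := by
    rw [htq pp x]
    have h1 : 0 ≤ X.qPilot (placeOf X pp.1 x) := by
      by_cases hS : placeOf X pp.1 x ∈ X.S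
      · rw [X.qPilot_apply_of_mem hS]
        exact div_nonneg (by exact_mod_cast (X.ordq_pos hS).le) X.two_mul_l_pos.le
      · rw [X.qPilot_apply_of_not_mem hS]
    have h2 : 0 < logNorm F (placeOf X pp.1 x) := logNorm_pos F _
    have h3 : (0 : ℝ) < localDegree F (placeOf X pp.1 x) := by exact_mod_cast localDegree_pos F _
    have : 0 ≤ X.qPilot (placeOf X pp.1 x) * logNorm F (placeOf X pp.1 x) / localDegree F (placeOf X pp.1 x) :=
      div_nonneg (mul_nonneg h1 h2.le) h3.le
    rw [neg_mul, neg_div]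
    linarith
  rwa [Real.log_nonpos_iff hq0.le] at hlog

include ht0 ht htq0 htq in
/-- A Θ-idele realising `P_Θ` has norm `≤ 1` (`‖t_{Θ,j,v}‖ ≤ ‖t_{q,v}‖ ≤ 1`, abc-iut-w4-d036). [cite: DupuyHilado2025, §3.3] -/
theorem norm_thetaIdele_le_one_of_realises (pp : Nat.Primes) (i : Fin X.lstar) (x : (thetaIndex X).Fibre (.inr pp)) :
    ‖t pp i x‖ ≤ 1 :=
  (thetaIdele_norm_le_qIdele_norm_of_realises X t ht0 ht tq htq0 htq pp i x).trans
    (norm_qIdele_le_one_of_realises X tq htq0 htq pp x)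

include ht0 ht htq0 htq in
/-- **`‖t_{Θ,j,v}‖ = ‖t_{q,v}‖^{j²}`** for realising ideles (`P_{Θ,j} = j²·P_q`; abc-iut-w4-d036's logarithmic form
exponentiated). [cite: DupuyHilado2025, §3.3, §3.4] -/
theorem norm_thetaIdele_eq_pow_of_realises (pp : Nat.Primes) (i : Fin X.lstar) (x : (thetaIndex X).Fibre (.inr pp)) :
    ‖t pp i x‖ = ‖tq pp x‖ ^ (((i : ℕ) + 1) ^ 2) := by
  haveI : Fact (pp : ℕ).Prime := ⟨pp.2⟩
  have hq0 : 0 < ‖tq pp x‖ := norm_pos_iff.mpr (htq0 pp x)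
  have ht0' : 0 < ‖t pp i x‖ := norm_pos_iff.mpr (ht0 pp i x)
  have h := log_norm_thetaIdele_eq_of_realises X t ht tq htq pp i x
  refine Real.log_injOn_pos ht0' (pow_pos hq0 _) ?_
  rw [h, Real.log_pow]
  push_cast
  ring

end Realising

/-! ## §2. `¬ Licence` for realising ideles with `‖t_{q,x₀}‖ < ε` -/

/-- **`¬ Licence` for every realising datum whose `q`-idele is small at ONE place over `p`.** For a prime `p` and a
label `j = i+1 ≥ 2` there is `ε > 0` — depending only on the setting data other than the ideles — such that for ALL
ideles `t`, `tq` realising `P_Θ`, `P_q` (Dupuy–Hilado (3.4); `tq` units off `S`) and every place `x₀ | p` with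
`‖t_{q,x₀}‖ < ε`, Step (xi-f)'s `Licence` FAILS for `settingPrVolSharp … tq t …` (parent file's threshold `C`:
`ε := min 1 (C·p)⁻¹`; with `‖t_{Θ,j,x₀}‖ = ‖t_{q,x₀}‖^{j²} ≤ p^{−m} < p·‖t_{q,x₀}‖^{j²}` one has
`p^{−m}·C < ‖t_{q,x₀}‖` since `j² ≥ 2`). [claim: Mochizuki2012, status: disputed] -/
theorem exists_eps_not_licence_settingPrVolSharp_of_realises (pp : Nat.Primes) (i : Fin (thetaIndex X).lstar)
    (hi : 1 ≤ (i : ℕ)) :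
    ∃ ε : ℝ, 0 < ε ∧
      ∀ (tq : ∀ (pp : Nat.Primes) (x : (thetaIndex X).Fibre (.inr pp)), haveI : Fact (pp : ℕ).Prime := ⟨pp.2⟩; kOf X pp.1 x)
        (t : ∀ (pp : Nat.Primes) (_ : Fin X.lstar) (x : (thetaIndex X).Fibre (.inr pp)),
          haveI : Fact (pp : ℕ).Prime := ⟨pp.2⟩; kOf X pp.1 x)
        (htq0 : ∀ pp x, tq pp x ≠ 0)
        (htq1 : ∀ (pp : Nat.Primes) (x : (thetaIndex X).Fibre (.inr pp)),
          haveI : Fact (pp : ℕ).Prime := ⟨pp.2⟩; placeOf X pp.1 x ∉ X.S → ‖tq pp x‖ = 1),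
        (∀ pp i x, t pp i x ≠ 0) →
        (∀ (pp : Nat.Primes) (i : Fin X.lstar) (x : (thetaIndex X).Fibre (.inr pp)),
          haveI : Fact (pp : ℕ).Prime := ⟨pp.2⟩
          Real.log ‖t pp i x‖ = -(X.thetaPilot i (placeOf X pp.1 x)) * logNorm F (placeOf X pp.1 x) /
            localDegree F (placeOf X pp.1 x)) →
        (∀ (pp : Nat.Primes) (x : (thetaIndex X).Fibre (.inr pp)),
          haveI : Fact (pp : ℕ).Prime := ⟨pp.2⟩
          Real.log ‖tq pp x‖ = -(X.qPilot (placeOf X pp.1 x)) * logNorm F (placeOf X pp.1 x) /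
            localDegree F (placeOf X pp.1 x)) →
        ∀ x₀ : (thetaIndex X).Fibre (.inr pp), ‖tq pp x₀‖ < ε →
          ¬ Thm311ToCor312.Licence
            (settingPrVolSharp X hlog M archPk archSub Ψ act Mmod region n lat sig split qData tq t htq0 htq1) := by
  haveI : Fact (pp : ℕ).Prime := ⟨pp.2⟩
  obtain ⟨C, hC0, hC⟩ := exists_threshold_not_licence_settingPrVolSharp X hlog M archPk archSub Ψ act Mmod region n lat
    sig split qData pp i
  have hp1 : (1 : ℝ) < (pp : ℕ) := by exact_mod_cast pp.2.one_lt
  have hp0 : (0 : ℝ) < (pp : ℕ) := zero_lt_one.trans hp1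
  refine ⟨min 1 (C * (pp : ℕ))⁻¹, lt_min zero_lt_one (inv_pos.2 (mul_pos hC0 hp0)),
    fun tq t htq0 htq1 ht0 ht htq x₀ hε => ?_⟩
  set Nq : ℝ := ‖tq pp x₀‖ with hNq
  have hN0 : 0 < Nq := norm_pos_iff.mpr (htq0 pp x₀)
  have hCp : 0 < C * (pp : ℕ) := mul_pos hC0 hp0
  have hN1 : Nq ≤ 1 := (lt_of_lt_of_le hε (min_le_left _ _)).le
  have hNC : Nq * (C * (pp : ℕ)) < 1 := by
    have h : Nq < (C * (pp : ℕ))⁻¹ := lt_of_lt_of_le hε (min_le_right _ _)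
    calc Nq * (C * (pp : ℕ)) < (C * (pp : ℕ))⁻¹ * (C * (pp : ℕ)) := mul_lt_mul_of_pos_right h hCp
      _ = 1 := inv_mul_cancel₀ hCp.ne'
  -- the label exponent `k = j² ≥ 2` and the `p`-power just above `‖t_q‖^k`
  set k : ℕ := ((i : ℕ) + 1) ^ 2 with hk
  have hk2 : 2 ≤ k := by
    have h2 : 2 ≤ (i : ℕ) + 1 := by omega
    calc 2 ≤ 2 ^ 2 := by norm_num
      _ ≤ ((i : ℕ) + 1) ^ 2 := Nat.pow_le_pow_left h2 2
  obtain ⟨nn, hn1, hn2⟩ := exists_mem_Ico_zpow (pow_pos hN0 k) hp1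
  have hnorm : ‖((pp : ℕ) : ℚ_[pp]) ^ (-(nn + 1))‖ = ((pp : ℕ) : ℝ) ^ (nn + 1) := by
    rw [Padic.norm_p_zpow, neg_neg]
  refine hC tq t htq0 htq1 (norm_thetaIdele_le_one_of_realises X t ht0 ht tq htq0 htq) x₀ (-(nn + 1)) ?_ ?_
  · -- `‖t_{Θ,j,x₀}‖ = ‖t_{q,x₀}‖^k ≤ p^(nn+1)`
    rw [hnorm, norm_thetaIdele_eq_pow_of_realises X t ht0 ht tq htq0 htq pp i x₀]
    exact hn2.le
  · -- `p^(nn+1)·C ≤ p·‖t_q‖^k·C ≤ ‖t_q‖·(‖t_q‖·C·p) < ‖t_q‖`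
    rw [hnorm, zpow_add_one₀ hp0.ne']
    have hkk : Nq ^ k ≤ Nq ^ 2 := pow_le_pow_of_le_one hN0.le hN1 hk2
    calc ((pp : ℕ) : ℝ) ^ nn * (pp : ℕ) * C ≤ Nq ^ k * (pp : ℕ) * C := by gcongr
      _ ≤ Nq ^ 2 * (pp : ℕ) * C := by gcongr
      _ = Nq * (Nq * (C * (pp : ℕ))) := by ring
      _ < Nq * 1 := mul_lt_mul_of_pos_left hNC hN0
      _ = Nq := mul_one _

/-! ## §3. The hull-level residual S_H under the q-pin fails in the same regime -/

/-- **S_H refuted in the small-`‖t_q‖` regime.** Over abc-iut-c312-5's lattice situation `LatticeSituation.ofShells` on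
the real log-shells (free column binders) with the Cor.-3.12 setting `settingPrVolSharp`, for a prime `p` and a label
`j = i+1 ≥ 2` there is `ε > 0` (free of the ideles) such that for ALL realising ideles, every place `x₀ | p` with
`‖t_{q,x₀}‖ < ε`, and EVERY region reading `ρ` / q-datum `qK` satisfying the q-PIN, abc-iut-w5-d068's hull-level residual
`Cor312Vol.PilotKummerCompatHull` (the S_H line of `Conditional.abc_of_S_v3`) FAILS — since under the q-pin it gives the
licence (`licence_of_pilotKummerCompatHull`). [claim: Mochizuki2012, status: disputed] -/
theorem exists_eps_not_pilotKummerCompatHull_settingPrVolSharp_of_realises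
    (frobAdm : ℤ → ℤ → ∀ (j : (thetaIndex X).Label) (vQ : (thetaIndex X).VQ),
      Set ((logShellsDH X logv).Packet j vQ) → Prop)
    (frobLogvol : ℤ → ℤ → ∀ (j : (thetaIndex X).Label) (vQ : (thetaIndex X).VQ),
      Set ((logShellsDH X logv).Packet j vQ) → ℝ)
    (frobΨ : ℤ → ℤ → ∀ v : (thetaIndex X).V, v ∈ (thetaIndex X).Vbad → Set ((logShellsDH X logv).StarPacket v))
    (frobMmod : ℤ → ℤ → ∀ j : (thetaIndex X).LabelStar, Set ((logShellsDH X logv).GlobalPacket j.1))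
    (unitImage : ℤ → ℤ → ℕ → ∀ (j : (thetaIndex X).Label) (vQ : (thetaIndex X).VQ),
      Set ((logShellsDH X logv).Packet j vQ))
    (ballImage : ℤ → ℤ → ∀ (j : (thetaIndex X).Label) (vQ : (thetaIndex X).VQ),
      Set ((logShellsDH X logv).Packet j vQ))
    (thetaDiv : ℤ → ℤ → LgpDivisor M (thetaIndex X).lstar)
    (pp : Nat.Primes) (i : Fin (thetaIndex X).lstar) (hi : 1 ≤ (i : ℕ)) :
    ∃ ε : ℝ, 0 < ε ∧
      ∀ (tq : ∀ (pp : Nat.Primes) (x : (thetaIndex X).Fibre (.inr pp)), haveI : Fact (pp : ℕ).Prime := ⟨pp.2⟩; kOf X pp.1 x)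
        (t : ∀ (pp : Nat.Primes) (_ : Fin X.lstar) (x : (thetaIndex X).Fibre (.inr pp)),
          haveI : Fact (pp : ℕ).Prime := ⟨pp.2⟩; kOf X pp.1 x)
        (htq0 : ∀ pp x, tq pp x ≠ 0)
        (htq1 : ∀ (pp : Nat.Primes) (x : (thetaIndex X).Fibre (.inr pp)),
          haveI : Fact (pp : ℕ).Prime := ⟨pp.2⟩; placeOf X pp.1 x ∉ X.S → ‖tq pp x‖ = 1),
        (∀ pp i x, t pp i x ≠ 0) →
        (∀ (pp : Nat.Primes) (i : Fin X.lstar) (x : (thetaIndex X).Fibre (.inr pp)),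
          haveI : Fact (pp : ℕ).Prime := ⟨pp.2⟩
          Real.log ‖t pp i x‖ = -(X.thetaPilot i (placeOf X pp.1 x)) * logNorm F (placeOf X pp.1 x) /
            localDegree F (placeOf X pp.1 x)) →
        (∀ (pp : Nat.Primes) (x : (thetaIndex X).Fibre (.inr pp)),
          haveI : Fact (pp : ℕ).Prime := ⟨pp.2⟩
          Real.log ‖tq pp x‖ = -(X.qPilot (placeOf X pp.1 x)) * logNorm F (placeOf X pp.1 x) /
            localDegree F (placeOf X pp.1 x)) →
        ∀ x₀ : (thetaIndex X).Fibre (.inr pp), ‖tq pp x₀‖ < ε →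
          ∀ (ρ : (∀ v : (thetaIndex X).V, v ∈ (thetaIndex X).Vbad → Set ((logShellsDH X logv).StarPacket v)) →
              ∀ (j : (thetaIndex X).Label) (vQ : (thetaIndex X).VQ), Set ((logShellsDH X logv).Packet j vQ))
            (qK : ∀ v : (thetaIndex X).V, v ∈ (thetaIndex X).Vbad → Set ((logShellsDH X logv).StarPacket v)),
            Cor312Vol.QPinned
              (LatticeSituation.ofShells (logShellsDH X logv) M archPk archSub (summandPiecesPr X hlog).Adm
                (summandPiecesPr X hlog).logvol Ψ act Mmod region frobAdm frobLogvol frobΨ frobMmod unitImage ballImage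
                thetaDiv)
              (settingPrVolSharp X hlog M archPk archSub Ψ act Mmod region n lat sig split qData tq t htq0 htq1) ρ qK →
            ¬ Cor312Vol.PilotKummerCompatHull
              (LatticeSituation.ofShells (logShellsDH X logv) M archPk archSub (summandPiecesPr X hlog).Adm
                (summandPiecesPr X hlog).logvol Ψ act Mmod region frobAdm frobLogvol frobΨ frobMmod unitImage ballImage
                thetaDiv)
              (settingPrVolSharp X hlog M archPk archSub Ψ act Mmod region n lat sig split qData tq t htq0 htq1) ρ qK := by
  obtain ⟨ε, hε0, hε⟩ := exists_eps_not_licence_settingPrVolSharp_of_realises X hlog M archPk archSub Ψ act Mmod region n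
    lat sig split qData pp i hi
  refine ⟨ε, hε0, fun tq t htq0 htq1 ht0 ht htq x₀ hx ρ qK hq hc => ?_⟩
  exact hε tq t htq0 htq1 ht0 ht htq x₀ hx
    (Cor312Vol.licence_of_pilotKummerCompatHull
      (LatticeSituation.ofShells (logShellsDH X logv) M archPk archSub (summandPiecesPr X hlog).Adm
        (summandPiecesPr X hlog).logvol Ψ act Mmod region frobAdm frobLogvol frobΨ frobMmod unitImage ballImage thetaDiv)
      _ ρ qK hq hc)

end Real

end Thm311

end IUTFork

end Summit.ABC

end
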